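import Summits.QuantumFields.BalabanUV.T4Continuum.Support.NE7QbarCurvedBaseTower
import Summits.QuantumFields.BalabanUV.T4Continuum.Support.NE7QbarCurvedBaseRadii
import Summits.QuantumFields.BalabanUV.T4Continuum.Support.NE3TopRadiusLetters
import HarnessLib

/-!
# NE7QbarCurvedBaseBudget — THE `ℓ¹` BASE-LIPSCHITZ CONSTANT OF THE STRAIGHT TOWER AT A CURVED BACKGROUND IN CLOSED FORM, FROM THE BOTTOM RELATIVE
# RADIUS `r₀` AND THE PLAQUETTE RADIUS `x` ALONE: `Λ ≤ K_maj·(L∕L^d)^k·(C₁·L^k·r₀ + C₂·(L²)^k·x)` — i.e. `M^{1−d}·O(α̂ + b)` in the letters `r₀ = α̂∕M`, `x = b∕M²`,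
# `M = L^{k+1}` — letter (L4) of the curved (APE) programme, file 7 (the budget)

Cell `pub-balaban`, rung (B)+1 sub-cell t4, lineage `b2b-balaban-t4-ne7-p1` (CRUX PROVER NE7 #1 = OWNER of row NE7), generation 76; memo
`t4/b2b-balaban-t4-ne7-p1-g76/TT-CURVED-LETTER.md` §2.  File F73 (over F68 `NE7QbarCurvedBaseTower.sum_norm_QbarIter_sub_QbarIter_le_Kmaj` (the tower letter with `K_maj`),
F69 `NE7QbarCurvedBaseRadii.norm_relLink_cavgIter_le_explicit` (the radii `ρ_i = L^i r₀ + (2κ₁∕L²)x_i`), row NE3-R2's `NE3TopRadiusLetters.iterate_prop1Radius_le_of_levelSmall`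
(`x_k ≤ (17∕16)(L²)^k x`), `NE7MajorantL1.sum_iterate_prop1Radius_le` (`Σ_{i≤k} x_i ≤ 2x_k`)).
WHY.  F71 consumes ONE number `Λ`; F68 gives it as `K_maj·q^k·Σ_{i≤k} λ(r_i, x_i)` (`q = L∕L^d`) in the relative radii `r_i` of the averaged pairs, F69 bounds those by the
explicit majorant.  THIS FILE does the real-number bookkeeping once: `λ(r,a) = D(2d+4)L²·r + D·E·a` (`D = d(2n_b+1)^d`, `E = (2d+4)L²·2n_b + 2(8L + c_loc)·16(d+1)(d+4)L²`),
`Σ_{i≤k} ρ_i ≤ 2L^k r₀ + (2κ₁∕L²)Σ_{i≤k} x_i`, `Σ_{i≤k} x_i ≤ (17∕8)(L²)^k x` — so `Σ_{i≤k} λ(ρ_i, x_i) ≤ 2D(2d+4)L²·L^k r₀ + (17∕8)(D(2d+4)·2κ₁ + D·E)·(L²)^k x`.  In the currencies of the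
memo (`M = L^{k+1}`, `r₀ = α̂∕M`, `x = b∕M²`): `q^k L^k r₀ = L^{d−2}·α̂·M^{1−d}` and `q^k (L²)^k x = L^{d−3}·b·M^{1−d}` — `Λ = M^{1−d}·O(α̂ + b)`, LEVEL-UNIFORM.
WHAT ([folklore]; 0 def, 0 sorry).
§1 `sum_pow_le'` (`Σ_{i≤k} L^i ≤ 2L^k`), `sum_lambda_majorant_le` — the displayed bound on `Σ_{i≤k} λ(ρ_i, x_i)`.
§2 **`sum_norm_QbarIter_sub_QbarIter_le_budget`** — for `U`, `W` unitary `(N·L^{k+1})`-periodic in the class at a common radius `x` (`L ≥ 2`) with `‖W⁻¹U − 1‖ ≤ r₀` everywhere and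
   `Y` `(N·L^{k+1})`-periodic:  `Σ_{z∈[0,N)^d}Σ_κ ‖QbarIter L (k+1) U Y − QbarIter L (k+1) W Y‖(z,κ) ≤ K_maj·(L∕L^d)^k·(2D(2d+4)L²·L^k·r₀ + (17∕8)(2D(2d+4)κ₁ + D·E)·(L²)^k·x)·‖Y‖₁`.
HONEST FRAMING (page 1): real-number bookkeeping over F68∕F69; the TT assembly is F70∕F71; (APE) NOT proved; NOT ONE-STEP, NOT NE7; spine 0∕9; finite T⁴ rung (B)+1 — NOT
infinite volume, NOT mass gap, NOT `BetaPertH`, NOT Clay.  Continuum YM on T⁴ ⇐ BetaPertH ∧ nine spine estimates (0/9 proved); BetaPertH ⇐ (D1) ∧ (D4) ∧ CAP+tail; G-an2-4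
gates asym, D1 and NE2/3/4.
-/

set_option autoImplicit false

open scoped BigOperators Matrix.Norms.L2Operator
open Finset

namespace Summit.QuantumFields.BalabanUV.T4Continuum.NE7QbarCurvedBaseBudget

open Literature.MathematicalPhysics.QuantumFieldTheory.Balaban1983to89
open B7Prop1Explicit B7Prop2Explicit
open T4AveragingDeficitWall (IsUnitaryCfg SmallField dirL1)
open T4AveragingDeficitWallBoundary (IsPeriodicCfg periodBox)
open AveragingDeficitPeriodicCounting (IsPeriodicDir)
open AveragingDeficitTwoLevelPrep (prop1Radius twoLevelSmall)
open AveragingDeficitMultiLevelPrep (cavgIter LevelSmall)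
open SpreadLift (loopRad)
open BlockAverageVaryHolo (nbRad)
open NE3TangentCovariantTower (QbarIter)
open NE7MajorantL1 (sum_iterate_prop1Radius_le iterate_prop1Radius_nonneg)
open NE3TopRadiusLetters (iterate_prop1Radius_le_of_levelSmall)
open NE7QbarCurvedBaseTower (sum_norm_QbarIter_sub_QbarIter_le_Kmaj)
open NE7QbarCurvedBaseRadii (norm_relLink_cavgIter_le_explicit)

noncomputable section

variable {d : ℕ}

/-! ## §1 The sums along the tower -/

/-- `Σ_{i<k+1} L^i ≤ 2·L^k` for `L ≥ 2`. [folklore] -/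
theorem sum_pow_le' {L : ℕ} (hL : 2 ≤ L) : ∀ k : ℕ, ∑ i ∈ Finset.range (k + 1), (L : ℝ) ^ i ≤ 2 * (L : ℝ) ^ k
  | 0 => by simp
  | k + 1 => by
      rw [Finset.sum_range_succ]
      have ih := sum_pow_le' hL k
      have hL2 : (2 : ℝ) ≤ L := by exact_mod_cast hL
      have hLk : (0 : ℝ) ≤ (L : ℝ) ^ k := by positivity
      calc _ ≤ 2 * (L : ℝ) ^ k + (L : ℝ) ^ (k + 1) := add_le_add ih le_rfl
        _ ≤ (L : ℝ) ^ (k + 1) + (L : ℝ) ^ (k + 1) := by rw [pow_succ]; nlinarith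
        _ = 2 * (L : ℝ) ^ (k + 1) := by ring

/-- **THE SUM OF THE ONE-LEVEL CONSTANTS ALONG THE EXPLICIT MAJORANT** (`L ≥ 2`, `x, r₀ ≥ 0`, `LevelSmall d L k x`): with `D = d(2n_b+1)^d`, `c = c_loc`,
`κ₁ = 2L n_b + 128(d+1)(d+4)L²`, `ρ_i = L^i r₀ + (2κ₁∕L²)x_i`,
`Σ_{i<k+1} D·((2d+4)L²(2n_b x_i + ρ_i) + (8L + c)(loopRad x_i + loopRad x_i)) ≤ D(2d+4)L²·2L^k·r₀ + (17∕8)(L²)^k x·(D(2d+4)·2κ₁ + D·((2d+4)L²·2n_b + 2(8L + c)·16(d+1)(d+4)L²))`. [folklore] -/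
theorem sum_lambda_majorant_le {L : ℕ} (hL : 2 ≤ L) (k : ℕ) {x r₀ : ℝ} (hx : 0 ≤ x) (hr₀ : 0 ≤ r₀) (hs : LevelSmall d L k x) :
    ∑ i ∈ Finset.range (k + 1), (d : ℝ) * (2 * nbRad d L + 1) ^ d
        * ((2 * (d : ℝ) + 4) * (L : ℝ) ^ 2 * (2 * ((nbRad d L : ℝ) * (prop1Radius d L)^[i] x)
            + ((L : ℝ) ^ i * r₀ + (2 * (2 * L * (nbRad d L : ℝ) + 128 * ((d : ℝ) + 1) * ((d : ℝ) + 4) * (L : ℝ) ^ 2) / (L : ℝ) ^ 2) * (prop1Radius d L)^[i] x))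
          + (8 * (L : ℝ) + (1250 * ((nbRad d L : ℝ) + L) + 8 * (d * L) + 2 * L))
              * (loopRad d L ((prop1Radius d L)^[i] x) + loopRad d L ((prop1Radius d L)^[i] x)))
      ≤ ((d : ℝ) * (2 * nbRad d L + 1) ^ d) * ((2 * (d : ℝ) + 4) * (L : ℝ) ^ 2) * (2 * (L : ℝ) ^ k) * r₀
        + (17 / 8 * ((L : ℝ) ^ 2) ^ k * x)
          * (((d : ℝ) * (2 * nbRad d L + 1) ^ d) * ((2 * (d : ℝ) + 4)
                * (2 * (2 * L * (nbRad d L : ℝ) + 128 * ((d : ℝ) + 1) * ((d : ℝ) + 4) * (L : ℝ) ^ 2)))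
            + ((d : ℝ) * (2 * nbRad d L + 1) ^ d) * ((2 * (d : ℝ) + 4) * (L : ℝ) ^ 2 * (2 * (nbRad d L : ℝ))
                + 2 * (8 * (L : ℝ) + (1250 * ((nbRad d L : ℝ) + L) + 8 * (d * L) + 2 * L)) * (16 * ((d : ℝ) + 1) * ((d : ℝ) + 4) * (L : ℝ) ^ 2))) := by
  have hL0 : (0 : ℝ) < L := by exact_mod_cast (show 0 < L by omega)
  -- abbreviations
  set D : ℝ := (d : ℝ) * (2 * nbRad d L + 1) ^ d with hD
  set c : ℝ := 1250 * ((nbRad d L : ℝ) + L) + 8 * (d * L) + 2 * L with hc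
  set κ : ℝ := 2 * L * (nbRad d L : ℝ) + 128 * ((d : ℝ) + 1) * ((d : ℝ) + 4) * (L : ℝ) ^ 2 with hκ
  set wl : ℝ := 16 * ((d : ℝ) + 1) * ((d : ℝ) + 4) * (L : ℝ) ^ 2 with hwl
  set xi : ℕ → ℝ := fun i => (prop1Radius d L)^[i] x with hxi
  have hD0 : 0 ≤ D := by rw [hD]; positivity
  have hc0 : 0 ≤ c := by rw [hc]; positivity
  have hκ0 : 0 ≤ κ := by rw [hκ]; positivity
  have hwl0 : 0 ≤ wl := by rw [hwl]; positivity
  have hxi0 : ∀ i, 0 ≤ xi i := fun i => iterate_prop1Radius_nonneg (d := d) L i hx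
  -- each term is affine in `(L^i r₀, x_i)`
  have hloop : ∀ i, loopRad d L (xi i) = wl * xi i := fun i => by simp only [loopRad, hwl]; ring
  have hterm : ∀ i, D * ((2 * (d : ℝ) + 4) * (L : ℝ) ^ 2 * (2 * ((nbRad d L : ℝ) * xi i) + ((L : ℝ) ^ i * r₀ + (2 * κ / (L : ℝ) ^ 2) * xi i))
        + (8 * (L : ℝ) + c) * (loopRad d L (xi i) + loopRad d L (xi i)))
      = D * ((2 * (d : ℝ) + 4) * (L : ℝ) ^ 2) * ((L : ℝ) ^ i * r₀)
        + (D * ((2 * (d : ℝ) + 4) * (2 * κ)) + D * ((2 * (d : ℝ) + 4) * (L : ℝ) ^ 2 * (2 * (nbRad d L : ℝ)) + 2 * (8 * (L : ℝ) + c) * wl)) * xi i := by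
    intro i; rw [hloop i]; field_simp; ring
  -- the two sums
  have hsumL : ∑ i ∈ Finset.range (k + 1), (L : ℝ) ^ i * r₀ ≤ 2 * (L : ℝ) ^ k * r₀ := by
    rw [← Finset.sum_mul]; exact mul_le_mul_of_nonneg_right (sum_pow_le' hL k) hr₀
  have hsumx : ∑ i ∈ Finset.range (k + 1), xi i ≤ 17 / 8 * ((L : ℝ) ^ 2) ^ k * x := by
    have h1 := sum_iterate_prop1Radius_le (d := d) hL k hx
    have h2 := iterate_prop1Radius_le_of_levelSmall (d := d) hL k hx hs
    simp only [hxi]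
    linarith
  have hA0 : 0 ≤ D * ((2 * (d : ℝ) + 4) * (L : ℝ) ^ 2) := by positivity
  have hB0 : 0 ≤ D * ((2 * (d : ℝ) + 4) * (2 * κ)) + D * ((2 * (d : ℝ) + 4) * (L : ℝ) ^ 2 * (2 * (nbRad d L : ℝ)) + 2 * (8 * (L : ℝ) + c) * wl) := by
    positivity
  calc ∑ i ∈ Finset.range (k + 1), D * ((2 * (d : ℝ) + 4) * (L : ℝ) ^ 2 * (2 * ((nbRad d L : ℝ) * xi i) + ((L : ℝ) ^ i * r₀ + (2 * κ / (L : ℝ) ^ 2) * xi i))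
          + (8 * (L : ℝ) + c) * (loopRad d L (xi i) + loopRad d L (xi i)))
      = ∑ i ∈ Finset.range (k + 1), (D * ((2 * (d : ℝ) + 4) * (L : ℝ) ^ 2) * ((L : ℝ) ^ i * r₀)
          + (D * ((2 * (d : ℝ) + 4) * (2 * κ)) + D * ((2 * (d : ℝ) + 4) * (L : ℝ) ^ 2 * (2 * (nbRad d L : ℝ)) + 2 * (8 * (L : ℝ) + c) * wl)) * xi i) :=
        Finset.sum_congr rfl fun i _ => hterm i
    _ = D * ((2 * (d : ℝ) + 4) * (L : ℝ) ^ 2) * ∑ i ∈ Finset.range (k + 1), (L : ℝ) ^ i * r₀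
        + (D * ((2 * (d : ℝ) + 4) * (2 * κ)) + D * ((2 * (d : ℝ) + 4) * (L : ℝ) ^ 2 * (2 * (nbRad d L : ℝ)) + 2 * (8 * (L : ℝ) + c) * wl))
          * ∑ i ∈ Finset.range (k + 1), xi i := by
        rw [Finset.sum_add_distrib, ← Finset.mul_sum, ← Finset.mul_sum]
    _ ≤ D * ((2 * (d : ℝ) + 4) * (L : ℝ) ^ 2) * (2 * (L : ℝ) ^ k * r₀)
        + (D * ((2 * (d : ℝ) + 4) * (2 * κ)) + D * ((2 * (d : ℝ) + 4) * (L : ℝ) ^ 2 * (2 * (nbRad d L : ℝ)) + 2 * (8 * (L : ℝ) + c) * wl))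
          * (17 / 8 * ((L : ℝ) ^ 2) ^ k * x) := add_le_add (mul_le_mul_of_nonneg_left hsumL hA0) (mul_le_mul_of_nonneg_left hsumx hB0)
    _ = _ := by ring

/-! ## §2 THE TOWER LETTER IN CLOSED FORM -/

/-- **THE `ℓ¹` BASE-LIPSCHITZ LETTER OF THE STRAIGHT TOWER AT A CURVED BACKGROUND, CLOSED FORM** (statement in the module docstring, §2): F68's tower letter with
F69's explicit radii and the class's radii bookkeeping — ONE constant from `r₀` and `x`. [folklore] -/
theorem sum_norm_QbarIter_sub_QbarIter_le_budget {n : Type*} [Fintype n] [DecidableEq n] [Nonempty n] {L : ℕ} (hL : 2 ≤ L) (k : ℕ) {N : ℕ} [NeZero N]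
    {U W : Site d → Fin d → (Matrix n n ℂ)ˣ} {x : ℝ} (hUu : IsUnitaryCfg U) (hWu : IsUnitaryCfg W) (hx : 0 ≤ x) (hs : LevelSmall d L k x)
    (hUx : SmallField U x) (hWx : SmallField W x) (hUP : IsPeriodicCfg U ((N * L ^ (k + 1) : ℕ) : ℤ)) (hWP : IsPeriodicCfg W ((N * L ^ (k + 1) : ℕ) : ℤ))
    {r₀ : ℝ} (hr0 : 0 ≤ r₀) (hr₀ : ∀ (y : Site d) (μ : Fin d), ‖(((W y μ)⁻¹ * U y μ : (Matrix n n ℂ)ˣ) : Matrix n n ℂ) - 1‖ ≤ r₀)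
    {Y : Site d → Fin d → Matrix n n ℂ} (hYP : IsPeriodicDir Y ((N * L ^ (k + 1) : ℕ) : ℤ)) :
    ∑ z ∈ periodBox (d := d) N, ∑ κ : Fin d, ‖QbarIter L (k + 1) U Y z κ - QbarIter L (k + 1) W Y z κ‖
      ≤ (Real.exp (((L : ℝ) ^ d / L) * ((d : ℝ) * (16 * ((d : ℝ) + 1) * ((d : ℝ) + 4) * (L : ℝ) ^ 2)
              * (1250 * ((nbRad d L : ℝ) + L) + 8 * ((d : ℝ) * L) + 2 * L)) * (2 / twoLevelSmall d L))
          * ((L : ℝ) / (L : ℝ) ^ d) ^ k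
          * (((d : ℝ) * (2 * nbRad d L + 1) ^ d) * ((2 * (d : ℝ) + 4) * (L : ℝ) ^ 2) * (2 * (L : ℝ) ^ k) * r₀
            + (17 / 8 * ((L : ℝ) ^ 2) ^ k * x)
              * (((d : ℝ) * (2 * nbRad d L + 1) ^ d) * ((2 * (d : ℝ) + 4)
                    * (2 * (2 * L * (nbRad d L : ℝ) + 128 * ((d : ℝ) + 1) * ((d : ℝ) + 4) * (L : ℝ) ^ 2)))
                + ((d : ℝ) * (2 * nbRad d L + 1) ^ d) * ((2 * (d : ℝ) + 4) * (L : ℝ) ^ 2 * (2 * (nbRad d L : ℝ))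
                    + 2 * (8 * (L : ℝ) + (1250 * ((nbRad d L : ℝ) + L) + 8 * (d * L) + 2 * L)) * (16 * ((d : ℝ) + 1) * ((d : ℝ) + 4) * (L : ℝ) ^ 2)))))
        * dirL1 Y (periodBox (d := d) (N * L ^ (k + 1))) := by
  have hL0 : (0 : ℝ) < L := by exact_mod_cast (show 0 < L by omega)
  -- the explicit radii of F69
  set ρ : ℕ → ℝ := fun i => (L : ℝ) ^ i * r₀
      + (2 * (2 * L * (nbRad d L : ℝ) + 128 * ((d : ℝ) + 1) * ((d : ℝ) + 4) * (L : ℝ) ^ 2) / (L : ℝ) ^ 2) * (prop1Radius d L)^[i] x with hρ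
  have hρ0 : ∀ i, 0 ≤ ρ i := fun i => by
    have := iterate_prop1Radius_nonneg (d := d) L i hx
    simp only [hρ]; positivity
  have hrad : ∀ i, i ≤ k → ∀ (y : Site d) (μ : Fin d),
      ‖(((cavgIter L i W y μ)⁻¹ * cavgIter L i U y μ : (Matrix n n ℂ)ˣ) : Matrix n n ℂ) - 1‖ ≤ ρ i :=
    fun i hi y μ => norm_relLink_cavgIter_le_explicit hL k hUu hWu hx hs hUx hWx hr₀ i hi y μ
  have htower := sum_norm_QbarIter_sub_QbarIter_le_Kmaj (d := d) hL k hUu hWu hx hs hUx hWx hUP hWP hρ0 hrad hYP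
  have hsum := sum_lambda_majorant_le (d := d) hL k hx hr0 hs
  refine htower.trans (mul_le_mul_of_nonneg_right (mul_le_mul_of_nonneg_left ?_ (by positivity)) ?_)
  · simp only [hρ] at hsum ⊢
    exact hsum
  · unfold dirL1; exact Finset.sum_nonneg fun _ _ => Finset.sum_nonneg fun _ _ => norm_nonneg _

end

end Summit.QuantumFields.BalabanUV.T4Continuum.NE7QbarCurvedBaseBudget
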